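import Summits.ValiantsHypothesis.ValiantsHypothesis.Theorems.NcSignSmallBall
import HarnessLib

/-!
# The ring certificate of a parse-tree shape — F2 of O-L6-21 (the few-shapes rung)

THE CERTIFICATE (`rings B S α top`, blob scale `B`). For a shape `S` placed at offset `α`, a node
is BIG if its size is `≥ B`. A RING is a pair (outer interval, inner interval or `(0,0)`) of
internal-node intervals, the inner NESTED in the outer; its position set is `ringSet`. Blobs (big
nodes with both children small) give the ring `(node, ∅)`; along a chain (exactly one big child)
the small pendants are accumulated from the block's top node and the ring `(top, big child)` is
CUT as soon as its mass reaches `B`; at a branch node (both children big) the block is dropped.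
INVARIANTS, each one structural induction over the seven node cases (`rings_node`):
`rings_wf` (outer = an internal node or the open block's top, inner = a nested internal node or
nothing, mass `≥ B`), ★ `rings_pairwise_disjoint`, ★ `card_ringSet_ge` (mass `≥ B`),
★ `length_rings` (`|S| + B ≤ 4B · #rings`: the slack `+B` absorbs the masses `< B` dropped at
blobs and branch nodes). F3 `NcShapeAnticoncentration` turns the rings into pairwise-disjoint
small-ball tests (F1 `small_ball_prod`) failed by every mask that designates no node of `S`.
ROLE IN THE SERIES (O-L6-21, decomp-valiant lens 6): F1 `NcSignSmallBall` → F2 (this) →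
F3 `NcShapeAnticoncentration` → F4 `NcFewShapesPermanent` (FLOS20 Theorem 23 / LLS18 Theorem 13
in kernel form). BY NAME: `Shape`, `Shape.size` (NcUniqueParseTree), `length_nodes` (NcParseTrees).
HONEST LINE: elementary combinatorics of ONE binary tree; instrument only; 0 S-currency;
closes NO item; A_nc stmt-23446 / PerNotNcVP / VP ≠ VNP untouched.
HONEST BOUNDARY pointer (verbatim sentence + critic LABEL in F4 `NcFewShapesPermanent`): the series
proves a RUNG on the commutativity dial in a RESTRICTED MODEL (few full-degree parse-tree SHAPES),
print-KNOWN (FLOS20 Thm 23 / LLS18 Thm 13), S-implied · WEAKER than A_nc =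
`CommutativityDial.PerNotNcVP` (stmt-23446, OPEN · UNDECIDED · IDEA-NEEDED); VP ≠ VNP untouched.
[cite: FijalkowLagardeOhlmannSerre2020, Lemma 21, Appendix]
[cite: LagardeLimayeSrinivasan2018, Claim 15]
-/

noncomputable section

open Finset

namespace Summit.ValiantsHypothesis.ValiantsHypothesis.Theorems.NcShapeRings

set_option linter.dupNamespace false
open Summit.ValiantsHypothesis.ValiantsHypothesis.Theorems.NcUniqueParseTree
  Summit.ValiantsHypothesis.ValiantsHypothesis.Theorems.NcParseTrees
  Summit.ValiantsHypothesis.ValiantsHypothesis.Theorems.NcSignSmallBall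

/-! ### §1 Internal nodes -/

/-- internal-node intervals `(offset, size)` of `S` placed at `α`, in preorder (the nodes `des`
scans). [cite: FijalkowLagardeOhlmannSerre2020, Theorem 5] -/
def inodes : Shape → ℕ → List (ℕ × ℕ)
  | .leaf, _ => []
  | .node l r, α => (α, l.size + r.size) :: (inodes l α ++ inodes r (α + l.size))

/-- [cite: FijalkowLagardeOhlmannSerre2020, Theorem 5] -/
theorem mem_inodes_left {l r : Shape} {α : ℕ} {I : ℕ × ℕ} (h : I ∈ inodes l α) :
    I ∈ inodes (.node l r) α :=
  List.mem_cons_of_mem _ (List.mem_append_left _ h)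

/-- [cite: FijalkowLagardeOhlmannSerre2020, Theorem 5] -/
theorem mem_inodes_right {l r : Shape} {α : ℕ} {I : ℕ × ℕ}
    (h : I ∈ inodes r (α + l.size)) : I ∈ inodes (.node l r) α :=
  List.mem_cons_of_mem _ (List.mem_append_right _ h)

/-- a shape of size `≥ 2` is an internal node.
[cite: FijalkowLagardeOhlmannSerre2020, Theorem 5] -/
theorem self_mem_inodes (S : Shape) (α : ℕ) (h : 2 ≤ S.size) :
    (α, S.size) ∈ inodes S α := by
  cases S with
  | leaf => exact absurd h (by simp only [Shape.size]; omega)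
  | node l r => exact List.mem_cons_self

/-- internal-node intervals sit inside the shape and have size `≥ 2`.
[cite: FijalkowLagardeOhlmannSerre2020, Theorem 5] -/
theorem inodes_sub : ∀ (S : Shape) (α : ℕ), ∀ I ∈ inodes S α,
    α ≤ I.1 ∧ I.1 + I.2 ≤ α + S.size ∧ 2 ≤ I.2 := by
  intro S
  induction S with
  | leaf => intro α I hI; simp [inodes] at hI
  | node l r ihl ihr =>
    intro α I hI
    have hl := (length_nodes l).2
    have hr := (length_nodes r).2
    simp only [inodes, List.mem_cons, List.mem_append, Shape.size] at hI ⊢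
    rcases hI with rfl | hI | hI
    · exact ⟨le_rfl, le_rfl, by omega⟩
    · obtain ⟨h1, h2, h3⟩ := ihl α I hI; exact ⟨h1, by omega, h3⟩
    · obtain ⟨h1, h2, h3⟩ := ihr (α + l.size) I hI; exact ⟨by omega, by omega, h3⟩

/-! ### §2 Rings and the certificate -/

/-- a RING: positions of the outer interval `R.1 = (a,m)` outside the inner interval
`R.2 = (a',m')`. [cite: FijalkowLagardeOhlmannSerre2020, Lemma 21] -/
def ringSet (d : ℕ) (R : (ℕ × ℕ) × (ℕ × ℕ)) : Finset (Fin d) :=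
  univ.filter (fun j : Fin d =>
    (R.1.1 ≤ j.val ∧ j.val < R.1.1 + R.1.2) ∧ ¬ (R.2.1 ≤ j.val ∧ j.val < R.2.1 + R.2.2))

/-- positions of a ring lie in its outer interval and outside its inner one.
[cite: FijalkowLagardeOhlmannSerre2020, Lemma 21] -/
theorem mem_ringSet {d : ℕ} {R : (ℕ × ℕ) × (ℕ × ℕ)} {j : Fin d} : j ∈ ringSet d R ↔
    (R.1.1 ≤ j.val ∧ j.val < R.1.1 + R.1.2) ∧
      ¬ (R.2.1 ≤ j.val ∧ j.val < R.2.1 + R.2.2) :=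
  Finset.mem_filter.trans (and_iff_right (Finset.mem_univ _))

/-- the RING CERTIFICATE at blob scale `B`: blobs (minimal nodes of size `≥ B`) give the ring
`(node, ∅)`; along a chain (exactly one child of size `≥ B`) the pendants are accumulated from
the block's top node `top` and a ring `(top, big child)` is CUT as soon as its mass reaches `B`;
at a branch node (both children `≥ B`) the open block is dropped.
[cite: FijalkowLagardeOhlmannSerre2020, Lemma 21] -/
def rings (B : ℕ) : Shape → ℕ → Option (ℕ × ℕ) → List ((ℕ × ℕ) × (ℕ × ℕ))
  | .leaf, _, _ => []
  | .node l r, α, top =>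
    if l.size + r.size < B then []
    else if B ≤ l.size ∧ B ≤ r.size then rings B l α none ++ rings B r (α + l.size) none
    else if B ≤ l.size then
      (if B ≤ (top.getD (α, l.size + r.size)).2 - l.size then
        (top.getD (α, l.size + r.size), (α, l.size)) :: rings B l α none
       else rings B l α (some (top.getD (α, l.size + r.size))))
    else if B ≤ r.size then
      (if B ≤ (top.getD (α, l.size + r.size)).2 - r.size then
        (top.getD (α, l.size + r.size), (α + l.size, r.size)) :: rings B r (α + l.size) none
       else rings B r (α + l.size) (some (top.getD (α, l.size + r.size))))
    else [((α, l.size + r.size), (0, 0))]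

/-- the seven cases of the certificate at an internal node (small · branch · left cut · left
chain · right cut · right chain · blob). [cite: FijalkowLagardeOhlmannSerre2020, Lemma 21] -/
theorem rings_node {B : ℕ} {l r : Shape} {α : ℕ} {top : Option (ℕ × ℕ)}
    (P : List ((ℕ × ℕ) × (ℕ × ℕ)) → Prop) (h0 : l.size + r.size < B → P [])
    (hb : B ≤ l.size → B ≤ r.size → P (rings B l α none ++ rings B r (α + l.size) none))
    (hlc : B ≤ l.size → r.size < B → B ≤ (top.getD (α, l.size + r.size)).2 - l.size →
      P ((top.getD (α, l.size + r.size), (α, l.size)) :: rings B l α none))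
    (hln : B ≤ l.size → r.size < B → (top.getD (α, l.size + r.size)).2 - l.size < B →
      P (rings B l α (some (top.getD (α, l.size + r.size)))))
    (hrc : l.size < B → B ≤ r.size → B ≤ (top.getD (α, l.size + r.size)).2 - r.size →
      P ((top.getD (α, l.size + r.size), (α + l.size, r.size)) :: rings B r (α + l.size) none))
    (hrn : l.size < B → B ≤ r.size → (top.getD (α, l.size + r.size)).2 - r.size < B →
      P (rings B r (α + l.size) (some (top.getD (α, l.size + r.size)))))
    (hbl : l.size < B → r.size < B → B ≤ l.size + r.size →
      P [((α, l.size + r.size), (0, 0))]) :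
    P (rings B (.node l r) α top) := by
  simp only [rings]
  split_ifs with h1 h2 h3 h4 h5 h6
  · exact h0 h1
  · exact hb h2.1 h2.2
  · exact hlc h3 (by omega) h4
  · exact hln h3 (by omega) (by omega)
  · exact hrc (by omega) h5 h6
  · exact hrn (by omega) h5 (by omega)
  · exact hbl (by omega) (by omega) (by omega)

/-- below blob scale `2` the certificate is empty (leaves are never big).
[cite: FijalkowLagardeOhlmannSerre2020, Lemma 21] -/
theorem two_le_of_mem_rings (B : ℕ) : ∀ (S : Shape) (α : ℕ) (top : Option (ℕ × ℕ)),
    ∀ R ∈ rings B S α top, 2 ≤ B := by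
  intro S
  induction S with
  | leaf => intro α top R hR; simp [rings] at hR
  | node l r ihl ihr =>
    intro α top
    have hl1 := (length_nodes l).2
    have hr1 := (length_nodes r).2
    refine rings_node (fun L => ∀ R ∈ L, 2 ≤ B) (fun _ R hR => by simp at hR)
      ?_ ?_ ?_ ?_ ?_ ?_
    · intro _ _ R hR
      rcases List.mem_append.1 hR with h | h
      · exact ihl _ _ R h
      · exact ihr _ _ R h
    all_goals intro _ _ _ _ _; omega

/-- WELL-FORMEDNESS of the certificate below a node placed at `α` inside an open block `top`, for a
set `N` of intervals containing the node's internal nodes and the block's top: every ring has outer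
interval in `N`, inner interval in `N` and NESTED in the outer one (or no inner interval), and mass
`≥ B`. [cite: FijalkowLagardeOhlmannSerre2020, Lemma 21] -/
theorem rings_wf (B : ℕ) (hB : 2 ≤ B) (N : ℕ × ℕ → Prop) : ∀ (S : Shape) (α : ℕ)
    (top : Option (ℕ × ℕ)), (∀ I ∈ inodes S α, N I) →
    (∀ T, top = some T → N T ∧ T.1 ≤ α ∧ α + S.size ≤ T.1 + T.2) →
    ∀ R ∈ rings B S α top, N R.1 ∧
      (R.2.2 = 0 ∨ (N R.2 ∧ R.1.1 ≤ R.2.1 ∧ R.2.1 + R.2.2 ≤ R.1.1 + R.1.2)) ∧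
      B ≤ R.1.2 - R.2.2 := by
  intro S
  induction S with
  | leaf => intro α top _ _ R hR; simp [rings] at hR
  | node l r ihl ihr =>
    intro α top hN hpre
    have hNl : ∀ I ∈ inodes l α, N I := fun I h => hN I (mem_inodes_left h)
    have hNr : ∀ I ∈ inodes r (α + l.size), N I := fun I h => hN I (mem_inodes_right h)
    -- the block passed on: `T' = top.getD (α, m)` is in `N` and contains the node
    have hT : N (top.getD (α, l.size + r.size)) ∧ (top.getD (α, l.size + r.size)).1 ≤ α ∧
        α + (l.size + r.size) ≤
          (top.getD (α, l.size + r.size)).1 + (top.getD (α, l.size + r.size)).2 := by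
      cases top with
      | none => exact ⟨hN _ List.mem_cons_self, le_rfl, le_rfl⟩
      | some T => exact hpre T rfl
    refine rings_node (fun L => ∀ R ∈ L, N R.1 ∧
        (R.2.2 = 0 ∨ (N R.2 ∧ R.1.1 ≤ R.2.1 ∧ R.2.1 + R.2.2 ≤ R.1.1 + R.1.2)) ∧
        B ≤ R.1.2 - R.2.2)
      (fun _ R hR => by simp at hR) ?_ ?_ ?_ ?_ ?_ ?_
    · intro _ _ R hR
      rcases List.mem_append.1 hR with hR | hR
      · exact ihl α none hNl (by simp) R hR
      · exact ihr _ none hNr (by simp) R hR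
    · intro hBl _ hcut R hR
      rcases List.mem_cons.1 hR with rfl | hR
      · exact ⟨hT.1, Or.inr ⟨hNl _ (self_mem_inodes l α (hB.trans hBl)), hT.2.1,
          by dsimp only; omega⟩, hcut⟩
      · exact ihl α none hNl (by simp) R hR
    · intro _ _ _
      exact ihl α (some _) hNl fun T hT' => by
        rw [Option.some.injEq] at hT'; subst hT'; exact ⟨hT.1, hT.2.1, by omega⟩
    · intro _ hBr hcut R hR
      rcases List.mem_cons.1 hR with rfl | hR
      · exact ⟨hT.1, Or.inr ⟨hNr _ (self_mem_inodes r _ (hB.trans hBr)), by dsimp only; omega,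
          by dsimp only; omega⟩, hcut⟩
      · exact ihr _ none hNr (by simp) R hR
    · intro _ _ _
      exact ihr _ (some _) hNr fun T hT' => by
        rw [Option.some.injEq] at hT'; subst hT'; exact ⟨hT.1, by omega, by omega⟩
    · intro _ _ hm R hR
      rw [List.mem_singleton] at hR
      subst hR
      exact ⟨hN _ List.mem_cons_self, Or.inl rfl, by dsimp only; omega⟩

/-- at the root: outer and inner intervals are internal nodes of `S`.
[cite: FijalkowLagardeOhlmannSerre2020, Lemma 21] -/
theorem rings_wf_root (B : ℕ) (hB : 2 ≤ B) (S : Shape) (α : ℕ) :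
    ∀ R ∈ rings B S α none, R.1 ∈ inodes S α ∧ (R.2.2 = 0 ∨
      (R.2 ∈ inodes S α ∧ R.1.1 ≤ R.2.1 ∧ R.2.1 + R.2.2 ≤ R.1.1 + R.1.2)) ∧
      B ≤ R.1.2 - R.2.2 :=
  rings_wf B hB (· ∈ inodes S α) S α none (fun _ h => h) (by simp)

/-- rings are pairwise disjoint (any placement, any open block).
[cite: FijalkowLagardeOhlmannSerre2020, Lemma 21] -/
theorem rings_disjoint (B : ℕ) (hB : 2 ≤ B) {d : ℕ} : ∀ (S : Shape) (α : ℕ)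
    (top : Option (ℕ × ℕ)),
    (rings B S α top).Pairwise (fun R R' => Disjoint (ringSet d R) (ringSet d R')) := by
  intro S
  induction S with
  | leaf => intro α top; simp [rings]
  | node l r ihl ihr =>
    intro α top
    -- rings emitted below a child with no open block stay inside the child
    have inside : ∀ (c : Shape) (β : ℕ), ∀ R ∈ rings B c β none, ∀ j ∈ ringSet d R,
        β ≤ j.val ∧ j.val < β + c.size := by
      intro c β R hR j hj
      have h1 := inodes_sub c β R.1 (rings_wf_root B hB c β R hR).1
      obtain ⟨h2, h3⟩ := (mem_ringSet.1 hj).1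
      omega
    refine rings_node (fun L => L.Pairwise fun R R' => Disjoint (ringSet d R) (ringSet d R'))
      (fun _ => List.Pairwise.nil) ?_ ?_ ?_ ?_ ?_ ?_
    · intro _ _
      refine List.pairwise_append.2 ⟨ihl α none, ihr _ none, fun R hR R' hR' => ?_⟩
      exact Finset.disjoint_left.2 fun j hj hj' => by
        have h1 := inside l α R hR j hj
        have h2 := inside r _ R' hR' j hj'
        omega
    · intro _ _ _
      refine List.pairwise_cons.2 ⟨fun R' hR' => Finset.disjoint_left.2 fun j hj hj' => ?_,
        ihl α none⟩
      exact (mem_ringSet.1 hj).2 (inside l α R' hR' j hj')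
    · intro _ _ _; exact ihl α (some _)
    · intro _ _ _
      refine List.pairwise_cons.2 ⟨fun R' hR' => Finset.disjoint_left.2 fun j hj hj' => ?_,
        ihr _ none⟩
      exact (mem_ringSet.1 hj).2 (inside r _ R' hR' j hj')
    · intro _ _ _; exact ihr _ (some _)
    · intro _ _ _; exact List.pairwise_singleton _ _

/-- ★ rings are pairwise disjoint. [cite: FijalkowLagardeOhlmannSerre2020, Lemma 21] -/
theorem rings_pairwise_disjoint (B : ℕ) (hB : 2 ≤ B) (S : Shape) {d : ℕ} (hS : S.size = d) :
    (rings B S 0 none).Pairwise (fun R R' => Disjoint (ringSet d R) (ringSet d R')) := by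
  subst hS
  exact rings_disjoint B hB S 0 none

/-- positions of an interval `[a, a+m) ⊆ [0, d)`: exactly `m`.
[cite: FijalkowLagardeOhlmannSerre2020, Lemma 21] -/
theorem card_iv {d : ℕ} (a m : ℕ) (h : a + m ≤ d) :
    (univ.filter (fun j : Fin d => a ≤ j.val ∧ j.val < a + m)).card = m := by
  have key : (univ.filter (fun j : Fin d => a ≤ j.val ∧ j.val < a + m)).map Fin.valEmbedding =
      Finset.Ico a (a + m) := by
    ext x
    simp only [Finset.mem_map, Finset.mem_filter, Finset.mem_univ, true_and,
      Fin.valEmbedding_apply, Finset.mem_Ico]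
    constructor
    · rintro ⟨j, hj, rfl⟩; exact hj
    · intro hx; exact ⟨⟨x, by omega⟩, hx, rfl⟩
  rw [← Finset.card_map Fin.valEmbedding, key, Nat.card_Ico]
  omega

/-- the inner interval of a well-formed ring lies inside the outer one, and the ring is their
difference. [cite: FijalkowLagardeOhlmannSerre2020, Lemma 21] -/
theorem inner_subset_outer {d : ℕ} (R : (ℕ × ℕ) × (ℕ × ℕ))
    (h : R.2.2 = 0 ∨ (R.1.1 ≤ R.2.1 ∧ R.2.1 + R.2.2 ≤ R.1.1 + R.1.2)) :
    univ.filter (fun j : Fin d => R.2.1 ≤ j.val ∧ j.val < R.2.1 + R.2.2) ⊆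
        univ.filter (fun j : Fin d => R.1.1 ≤ j.val ∧ j.val < R.1.1 + R.1.2) ∧
      ringSet d R = univ.filter (fun j : Fin d => R.1.1 ≤ j.val ∧ j.val < R.1.1 + R.1.2) \
        univ.filter (fun j : Fin d => R.2.1 ≤ j.val ∧ j.val < R.2.1 + R.2.2) := by
  refine ⟨fun j hj => ?_, ?_⟩
  · rw [Finset.mem_filter] at hj ⊢
    exact ⟨hj.1, by omega⟩
  · ext j
    rw [mem_ringSet, Finset.mem_sdiff, Finset.mem_filter, Finset.mem_filter]
    simp only [Finset.mem_univ, true_and]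

/-- ★ every ring has mass `≥ B`. [cite: FijalkowLagardeOhlmannSerre2020, Lemma 21] -/
theorem card_ringSet_ge (B : ℕ) (hB : 2 ≤ B) (S : Shape) {d : ℕ} (hS : S.size = d) :
    ∀ R ∈ rings B S 0 none, B ≤ (ringSet d R).card := by
  subst hS
  intro R hR
  obtain ⟨w1, w2, w3⟩ := rings_wf_root B hB S 0 R hR
  have h1 := inodes_sub S 0 R.1 w1
  obtain ⟨hsub, hset⟩ := inner_subset_outer (d := S.size) R (w2.imp_right fun h => h.2)
  rw [hset, Finset.card_sdiff_of_subset hsub, card_iv _ _ (by omega)]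
  rcases w2 with h0 | ⟨h2, -, h4⟩
  · rw [Finset.filter_false_of_mem (fun j _ => by omega), Finset.card_empty]
    omega
  · rw [card_iv _ _ (by have := inodes_sub S 0 R.2 h2; omega)]
    exact w3

/-- COUNT below a node of size `≥ B` reached inside an open block `T` with pending mass
`T.2 − |S| < B`: `T.2 + B ≤ 4B · #rings` (no block: `|S| + B ≤ 4B · #rings`).
[cite: FijalkowLagardeOhlmannSerre2020, Lemma 21] -/
theorem length_rings_aux (B : ℕ) (hB : 2 ≤ B) : ∀ (S : Shape) (α : ℕ)
    (top : Option (ℕ × ℕ)), B ≤ S.size →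
    (∀ T, top = some T → S.size ≤ T.2 ∧ T.2 < S.size + B) →
    (top.getD (α, S.size)).2 + B ≤ 4 * B * (rings B S α top).length := by
  intro S
  induction S with
  | leaf => intro α top h _; exact absurd h (by simp only [Shape.size]; omega)
  | node l r ihl ihr =>
    intro α top hBm hpre
    have hl1 := (length_nodes l).2
    have hr1 := (length_nodes r).2
    simp only [Shape.size] at hBm hpre ⊢
    have hT : l.size + r.size ≤ (top.getD (α, l.size + r.size)).2 ∧
        (top.getD (α, l.size + r.size)).2 < l.size + r.size + B := by
      cases top with
      | none => simp only [Option.getD_none]; omega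
      | some T => exact hpre T rfl
    refine rings_node (fun L => (top.getD (α, l.size + r.size)).2 + B ≤ 4 * B * L.length)
      (fun h => absurd hBm (by omega)) ?_ ?_ ?_ ?_ ?_ ?_
    · intro hBl hBr
      have h1 := ihl α none hBl (by simp)
      have h2 := ihr (α + l.size) none hBr (by simp)
      simp only [Option.getD_none] at h1 h2
      rw [List.length_append, Nat.mul_add]
      omega
    · intro hBl _ _
      have h1 := ihl α none hBl (by simp)
      simp only [Option.getD_none] at h1
      rw [List.length_cons, Nat.mul_succ]
      omega
    · intro hBl _ hnc
      have h1 := ihl α (some (top.getD (α, l.size + r.size))) hBl (fun T hT' => by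
        rw [Option.some.injEq] at hT'; subst hT'; omega)
      simpa only [Option.getD_some] using h1
    · intro _ hBr _
      have h2 := ihr (α + l.size) none hBr (by simp)
      simp only [Option.getD_none] at h2
      rw [List.length_cons, Nat.mul_succ]
      omega
    · intro _ hBr hnc
      have h2 := ihr (α + l.size) (some (top.getD (α, l.size + r.size))) hBr (fun T hT' => by
        rw [Option.some.injEq] at hT'; subst hT'; omega)
      simpa only [Option.getD_some] using h2
    · intro _ _ _
      rw [List.length_singleton]
      omega

/-- ★ there are many rings: `|S| + B ≤ 4B · #rings` once `|S| ≥ B ≥ 2`.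
[cite: FijalkowLagardeOhlmannSerre2020, Lemma 21] -/
theorem length_rings (B : ℕ) (hB : 2 ≤ B) (S : Shape) (hS : B ≤ S.size) :
    S.size + B ≤ 4 * B * (rings B S 0 none).length := by
  simpa only [Option.getD_none] using length_rings_aux B hB S 0 none hS (by simp)

end Summit.ValiantsHypothesis.ValiantsHypothesis.Theorems.NcShapeRings
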